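import Summits.QuantumFields.BalabanUV.T4Continuum.Support.VariationalVectorEndMonotone
import Summits.QuantumFields.BalabanUV.T4Continuum.Support.VariationalVectorOneStepPhys
import Summits.QuantumFields.BalabanUV.T4Continuum.Support.VariationalVectorOneStepSlice

/-!
# T⁴ programme, spine node NE2 (U1a), lane P2 — (M4) THE UPPER BRACKET FROM V-ONE's CURL COMPETITOR AND A FINE-LEVEL SLICE MOVE AT THAT COMPETITOR
# (the decomposition of (ONE-min) with background into its landed half and its open half; abstract + vector letters; model level; cell `pub-balaban`)

NE2 formalisation swarm `b2b-balaban-t4-ne2-formalise-*`, leaf prover 10 GEN 3 (`prover-b2b-balaban-t4-ne2-formalise-leaf-10-g3-0`, V-END holder lineage); memo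
`t4/T4-EST-NE2-P2-VEND.md` (O-V1); journal INTENT «(M4)».  The supplier shapes (C)∕(F) below are this seat's typing of leaf-01-g7's memo (V5); a sibling with adjusted
shapes is cheap if the supplier seat needs one.

THE POINT.  The monotone END (`VariationalVectorEndMonotone.effV_tendsto_of_bracket`, v1.1) needs, per level, the UPPER bracket `Δ_{k+1}(φ) ≤ Δ_k(φ) + e_k‖φ‖²` with
`Σ e_k < ∞`.  (ONE-min) delivers it (`upper_bracket_of_oneMin`), but with background (ONE-min) is itself open.  Its natural supplier splits into
 (C) V-ONE's CURL COMPETITOR — at a coarse minimiser `f₀` a fine field `g₁` of the COMPOSITE fibre with PURE-CURL fine form `Sff g₁ ≤ (√(Sc f₀ + ε₁ρ f₀) + δ′√(qW f₀))²` AND a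
     size bound `qV g₁ ≤ C_I·(qW f₀ + Sc f₀ + ρ f₀)` (the tilted interpolants `interpV` of V-ONE-1F p219670 ∕ p220658 and the taxi competitor of p221223 are of this kind — value +
     covariant-difference corrections, so their size is controlled by the coarse size, the coarse energy (through a Gårding-type bound on the rough gradient) and ∕ or the regularity
     functional `ρ`; the value clause is LANDED (`exists_oneStep_vector`, `blockSpin_lineT_taxi_le_of_ub`), the size clause is NOT yet in the tree), and
 (F) a FINE-LEVEL SLICE MOVE AT `g₁` inside the composite fibre: `∃ g, Qk (Q₁ g) = Qk (Q₁ g₁) ∧ Sf g ≤ (1 + τ′)·Sff g₁ + τ·qV g₁` — OPEN with background (the fine analogue of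
     (SLICE-min)).  STATUS OF ROUTE (F) (leaf-01-g8's SHAPE CORRECTION, CLAIMS.log 2026-08-20 17:19Z l.18192 (3)): at the competitor of a coarse MINIMISER the fine slice move pays
     the plaquette-commutator cross term at FIRST order in the curvature class, and `G′(J W₀)` is itself `O(c²)·action` — so `τ′_k ≳ O(c²)` is predicted NON-summable on this
     route, while the true upper defect IS summable (F-ne2leaf01g7-3: flat part ∝ L^{−2k} + background part ∝ c·L^{−k}).  THE FAVOURED ROUTE is leaf-01-g8's (G′) «V-ONE-G WITH
     BACKGROUND» (INTENT l.18200): (C) read at `G := 0` on the coarse side + an interpolation law `G′(J W) ≤ G(W) + ε_G·ρ̃(W)` for the SAME competitor, NO slice move — it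
     yields (ONE-min) ITSELF (`oneMin_of_curl_oneG`, leaf-01-g8's file) and therefore plugs into `VariationalVectorEndMonotone.upper_bracket_of_oneMin` ∕ `effV_tendsto_of_upper`
     (p226720) with no new bracket lemma; the (G′)-variant is deliberately NOT duplicated here.  Route (F) is kept as typed bookkeeping for competitors other than the
     minimiser's interpolant.
 * **`upper_bracket_of_curl_fineSlice`** (abstract): (C) ∧ (F) + coarse V-UB ∕ V-P ∕ V-REG ⟹ `blockSpin (Qk ∘ Q₁) Sf μ ≤ blockSpin Qk Sc μ + e″·qZ μ` with
   `e″ = τ′·Λ + (1+τ′)·ePV Λ C_P C_R ε₁ δ′ + τ·C_I·(C_P(Λ+1) + Λ + C_R(Λ+1))` — so the monotone END's summability asks `Σ_k (τ′_k + τ_k + ε₁-part + δ′-part) < ∞`: the multiplicative fine-slice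
   excess `τ′_k` MUST be summable along the tower (a bounded non-decaying `τ′` is NOT enough for this route).
 * **`vector_upper_bracket_curl_fineSlice`** (vector letters, `E = ℂ`, any one-step map `Q₁`).
 * §4 **`oneStep_vector_sized`** — THE (C) BINDER DISCHARGED AT FRAME CARRIERS (for ANY coarse `G ≥ 0`, in particular at `G := 0` = leaf-01-g8's (C)₀): V-ONE-1F's competitor `interpV W₀` (`SfV_interpV_le` + `QvL_interpV`, p219670 lineage) WITH
   the size clause from leaf-01-g6's `VariationalVectorOneStepSlice.qVV_interpV_le` (p221158: `qVV (interpV W) ≤ (4(1+d²)+50)·qWV W` — the competitor's size is controlled by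
   the coarse SIZE alone), at `Q₁ := QvL L (fine n M) (frameT U′ Rc)`, ANY coarse average `Qk`, `ρ := rhoV n M Rc`, `ε₁ := 4(d+26)L∕n²`, `C_I := 4(1+d²)+50`: so on this route
   the existence half with background at frame-carrier data displays ONLY (F), V-REG (leaf-03-g6: kernel modulo V-UB∕V-P∕(Går)∕(GF3) for the covariant `projG`), coarse
   V-UB∕V-P and the decay∕class binders.
 * §3 **`le_geometric_of_eventually`**: a defect bounded by `B` before level `k₀` and by `Cθ^k` from `k₀` on is `≤ max C (B∕θ^k₀)·θ^k` at every level — the rate constant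
   of a pre-asymptotic plateau, i.e. how the END's ∀k decay binders absorb «geometric only from level k₀ on» (leaf-01-g7's F-ne2leaf01g7-2 plateau `≈ 0.16c²` in the LOWER
   defect, which F-ne2leaf01g7-3 shows ENDS at `n·c ≈ 10–15`, after which `dn ≈ 1.2c∕n`, `θ = L⁻¹`).

HONEST FRAMING (T4-DAG p. 1).  Bookkeeping at MODEL level; every law DISPLAYED; nothing discharged; no `def`, no `sorry`.  V-END with background ∕ NE2 NOT proved; NE3 OPEN; spine
PROVED 0∕9; rung (B)+1 finite T⁴ — NOT infinite volume, NOT mass gap, NOT Clay.  HONEST DEPENDENCY (cell, verbatim): continuum YM on T⁴ ⇐ BetaPertH ∧ nine spine estimates (0/9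
proved); BetaPertH ⇐ (D1) ∧ (D4) ∧ CAP+tail; G-an2-4 gates asym, D1 and NE2/3/4.
-/

noncomputable section

namespace Summit.QuantumFields.BalabanUV.T4Continuum.VariationalVectorEndMonotoneCurl

open Finset
open scoped Matrix ComplexConjugate ComplexOrder BigOperators
open Literature.MathematicalPhysics.QuantumFieldTheory.Balaban1983to89.B5Prop11Plancherel (Tor fine unitVec)
open Summit.QuantumFields.BalabanUV.T4Continuum.VariationalTransfer (blockSpin blockSpin_le blockSpin_eq_of_isMin)
open Summit.QuantumFields.BalabanUV.T4Continuum.VariationalCovariantAssembly (exists_isMinOn_fib defect_bound)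
open Summit.QuantumFields.BalabanUV.T4Continuum.VectorBlockTrialForm (nsqV nsqV_nonneg QvL)
open Summit.QuantumFields.BalabanUV.T4Continuum.VariationalVectorForm
open Summit.QuantumFields.BalabanUV.T4Continuum.VariationalVectorEndOfLeaves (ePV ePV_nonneg)

/-! ## §1 Abstract -/

section Abstract

variable {V W Z : Type*} [NormedAddCommGroup W] [ProperSpace W] [TopologicalSpace Z] [T1Space Z]

/-- **THE UPPER BRACKET FROM (C) V-ONE's CURL COMPETITOR WITH SIZE CONTROL AND (F) A FINE-LEVEL SLICE MOVE AT THAT COMPETITOR.**  Defect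
`e″ = τ′·Λ + (1+τ′)·e′ + τ·C_I·(C_P(Λ+1) + Λ + C_R(Λ+1))`, `e′ = ePV Λ C_P C_R ε₁ δ′`. [folklore] -/
theorem upper_bracket_of_curl_fineSlice
    {Qk : W → Z} {Q₁ : V → W} {Sc : W → ℝ} {Sf Sff : V → ℝ} {qW : W → ℝ} {qV : V → ℝ} {qZ : Z → ℝ} {ρ : W → ℝ}
    (hQk : Continuous Qk) (hSc : Continuous Sc) (hSc0 : ∀ f, 0 ≤ Sc f) (hSf0 : ∀ f', 0 ≤ Sf f') (hqW0 : ∀ f, 0 ≤ qW f) (hqZ0 : ∀ μ, 0 ≤ qZ μ)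
    (hρ0 : ∀ f, 0 ≤ ρ f)
    {κ Λ CP CR CI ε₁ δ' τ τ' : ℝ} (hκ : 0 ≤ κ) (hΛ : 0 ≤ Λ) (hCP : 0 ≤ CP) (hCR : 0 ≤ CR) (hCI : 0 ≤ CI) (hε₁ : 0 ≤ ε₁) (hδ' : 0 ≤ δ') (hτ : 0 ≤ τ)
    (hτ' : 0 ≤ τ')
    (hnormW : ∀ f, ‖f‖ ^ 2 ≤ κ * qW f)
    (hUBc : ∀ μ, ∃ f, Qk f = μ ∧ Sc f ≤ Λ * qZ μ)
    (hPc : ∀ f, qW f ≤ CP * (Sc f + qZ (Qk f)))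
    (hREG : ∀ μ f, Qk f = μ → (∀ g, Qk g = μ → Sc f ≤ Sc g) → ρ f ≤ CR * (Sc f + qZ μ))
    -- (C) V-ONE's curl competitor at coarse minimisers, into the composite fibre, with size control
    (hONEc : ∀ μ f₀, Qk f₀ = μ → (∀ f, Qk f = μ → Sc f₀ ≤ Sc f) →
      ∃ g₁, Qk (Q₁ g₁) = μ ∧ Sff g₁ ≤ (Real.sqrt (Sc f₀ + ε₁ * ρ f₀) + δ' * Real.sqrt (qW f₀)) ^ 2 ∧ qV g₁ ≤ CI * (qW f₀ + Sc f₀ + ρ f₀))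
    -- (F) the fine-level slice move at such competitors
    (hfine : ∀ μ g₁, Qk (Q₁ g₁) = μ → ∃ g, Qk (Q₁ g) = μ ∧ Sf g ≤ Sff g₁ + τ' * Sff g₁ + τ * qV g₁)
    (μ : Z) :
    blockSpin (Qk ∘ Q₁) Sf μ ≤ blockSpin Qk Sc μ
        + (τ' * Λ + (1 + τ') * ePV Λ CP CR ε₁ δ' + τ * (CI * (CP * (Λ + 1) + Λ + CR * (Λ + 1)))) * qZ μ := by
  -- the coarse minimiser
  obtain ⟨fU, hfU, hfUb⟩ := hUBc μ
  obtain ⟨f₀, hf₀, hmin⟩ := exists_isMinOn_fib (qZ := qZ) hQk hSc hκ hCP hnormW hPc hfU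
  have hSc_le : Sc f₀ ≤ Λ * qZ μ := (hmin fU hfU).trans hfUb
  have hqW_le : qW f₀ ≤ CP * (Λ + 1) * qZ μ := by
    calc qW f₀ ≤ CP * (Sc f₀ + qZ (Qk f₀)) := hPc f₀
      _ ≤ CP * (Λ * qZ μ + qZ μ) := by rw [hf₀]; gcongr
      _ = CP * (Λ + 1) * qZ μ := by ring
  have hρ_le : ρ f₀ ≤ CR * (Λ + 1) * qZ μ := by
    calc ρ f₀ ≤ CR * (Sc f₀ + qZ μ) := hREG μ f₀ hf₀ hmin
      _ ≤ CR * (Λ * qZ μ + qZ μ) := by gcongr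
      _ = CR * (Λ + 1) * qZ μ := by ring
  -- (C): the curl competitor and its pure-curl value as an additive defect `e′·qZ μ`
  obtain ⟨g₁, hg₁, hcurl, hsize⟩ := hONEc μ f₀ hf₀ hmin
  have hc : Sff g₁ ≤ Sc f₀ + ePV Λ CP CR ε₁ δ' * qZ μ := by
    have h := hcurl
    have hs0 : 0 ≤ Sc f₀ + ε₁ * ρ f₀ := add_nonneg (hSc0 f₀) (mul_nonneg hε₁ (hρ0 f₀))
    have hs : Sc f₀ + ε₁ * ρ f₀ ≤ (Λ + ε₁ * CR * (Λ + 1)) * qZ μ := by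
      nlinarith [hSc_le, mul_le_mul_of_nonneg_left hρ_le hε₁]
    have hΛ' : 0 ≤ Λ + ε₁ * CR * (Λ + 1) := by positivity
    have hdef := defect_bound (s := Sc f₀ + ε₁ * ρ f₀) (v := qW f₀) (z := qZ μ) (Λ := Λ + ε₁ * CR * (Λ + 1)) (P := CP * (Λ + 1))
      hδ' hΛ' (by positivity) (hqZ0 μ) hs hqW_le
    rw [add_sq, Real.sq_sqrt hs0, mul_pow, Real.sq_sqrt (hqW0 f₀)] at h
    have hρ' : ε₁ * ρ f₀ ≤ ε₁ * CR * (Λ + 1) * qZ μ := by nlinarith [mul_le_mul_of_nonneg_left hρ_le hε₁]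
    unfold ePV
    linarith
  -- (F): the fine slice move at `g₁`
  obtain ⟨g, hg, hfg⟩ := hfine μ g₁ hg₁
  have hS' : Sff g₁ ≤ (Λ + ePV Λ CP CR ε₁ δ') * qZ μ := by nlinarith [hSc_le]
  have hsize' : qV g₁ ≤ CI * (CP * (Λ + 1) + Λ + CR * (Λ + 1)) * qZ μ := by
    have h3 : qW f₀ + Sc f₀ + ρ f₀ ≤ (CP * (Λ + 1) + Λ + CR * (Λ + 1)) * qZ μ := by linarith
    calc qV g₁ ≤ CI * (qW f₀ + Sc f₀ + ρ f₀) := hsize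
      _ ≤ CI * ((CP * (Λ + 1) + Λ + CR * (Λ + 1)) * qZ μ) := mul_le_mul_of_nonneg_left h3 hCI
      _ = CI * (CP * (Λ + 1) + Λ + CR * (Λ + 1)) * qZ μ := by ring
  have htot : Sf g ≤ Sc f₀ + (τ' * Λ + (1 + τ') * ePV Λ CP CR ε₁ δ' + τ * (CI * (CP * (Λ + 1) + Λ + CR * (Λ + 1)))) * qZ μ := by
    have h1 : τ' * Sff g₁ ≤ τ' * ((Λ + ePV Λ CP CR ε₁ δ') * qZ μ) := mul_le_mul_of_nonneg_left hS' hτ'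
    have h2 : τ * qV g₁ ≤ τ * (CI * (CP * (Λ + 1) + Λ + CR * (Λ + 1)) * qZ μ) := mul_le_mul_of_nonneg_left hsize' hτ
    nlinarith [hfg, hc]
  rw [blockSpin_eq_of_isMin hSc0 hf₀ hmin]
  have hg' : (Qk ∘ Q₁) g = μ := by simpa using hg
  exact (blockSpin_le hSf0 hg').trans htot

end Abstract

/-! ## §2 Vector letters -/

section Vector

variable {d : ℕ} (n L : ℕ) [NeZero n] [NeZero L] (M : Fin d → ℕ) [hM : ∀ μ, NeZero (M μ)]

/-- **THE UPPER BRACKET FROM (C) + (F), VECTOR LETTERS** (`E = ℂ`, any one-step map `Q₁`): `Sc := ScV R G`, `Sf := SfV R′ G′`, `Sff := SfV R′ 0` (pure curl), `qW := qWV`,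
`qV := qVV`, `qZ := nsqV M`. [folklore] -/
theorem vector_upper_bracket_curl_fineSlice
    {R : Tor (fine n M) → Fin d → (ℂ →L[ℂ] ℂ)} {R' : Tor (fine L (fine n M)) → Fin d → (ℂ →L[ℂ] ℂ)}
    {G : (Tor (fine n M) → Fin d → ℂ) → ℝ} {G' : (Tor (fine L (fine n M)) → Fin d → ℂ) → ℝ}
    {Qk : (Tor (fine n M) → Fin d → ℂ) → (Tor M → Fin d → ℂ)} {Q₁ : (Tor (fine L (fine n M)) → Fin d → ℂ) → (Tor (fine n M) → Fin d → ℂ)}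
    (hQk : Continuous Qk) (hG0 : ∀ W, 0 ≤ G W) (hGc : Continuous G) (hG0' : ∀ W', 0 ≤ G' W')
    {Λ CP CR CI ε₁ δ' τ τ' : ℝ} (hΛ : 0 ≤ Λ) (hCP : 0 ≤ CP) (hCR : 0 ≤ CR) (hCI : 0 ≤ CI) (hε₁ : 0 ≤ ε₁) (hδ' : 0 ≤ δ') (hτ : 0 ≤ τ) (hτ' : 0 ≤ τ')
    {ρ : (Tor (fine n M) → Fin d → ℂ) → ℝ} (hρ0 : ∀ W, 0 ≤ ρ W)
    (hUBc : ∀ φ : Tor M → Fin d → ℂ, ∃ W, Qk W = φ ∧ ScV n M R G W ≤ Λ * nsqV M φ)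
    (hPc : ∀ W, qWV n M W ≤ CP * (ScV n M R G W + nsqV M (Qk W)))
    (hREG : ∀ (φ : Tor M → Fin d → ℂ) W, Qk W = φ → (∀ W₂, Qk W₂ = φ → ScV n M R G W ≤ ScV n M R G W₂) →
      ρ W ≤ CR * (ScV n M R G W + nsqV M φ))
    (hONEc : ∀ (φ : Tor M → Fin d → ℂ) (W₀ : Tor (fine n M) → Fin d → ℂ), Qk W₀ = φ → (∀ W, Qk W = φ → ScV n M R G W₀ ≤ ScV n M R G W) →
      ∃ g₁, Qk (Q₁ g₁) = φ ∧ SfV n L M R' (fun _ => 0) g₁ ≤ (Real.sqrt (ScV n M R G W₀ + ε₁ * ρ W₀) + δ' * Real.sqrt (qWV n M W₀)) ^ 2 ∧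
        qVV n L M g₁ ≤ CI * (qWV n M W₀ + ScV n M R G W₀ + ρ W₀))
    (hfine : ∀ (φ : Tor M → Fin d → ℂ) g₁, Qk (Q₁ g₁) = φ →
      ∃ g, Qk (Q₁ g) = φ ∧ SfV n L M R' G' g ≤ SfV n L M R' (fun _ => 0) g₁ + τ' * SfV n L M R' (fun _ => 0) g₁ + τ * qVV n L M g₁)
    (φ : Tor M → Fin d → ℂ) :
    blockSpin (Qk ∘ Q₁) (SfV n L M R' G') φ ≤ blockSpin Qk (ScV n M R G) φ
        + (τ' * Λ + (1 + τ') * ePV Λ CP CR ε₁ δ' + τ * (CI * (CP * (Λ + 1) + Λ + CR * (Λ + 1)))) * nsqV M φ := by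
  have hn0 : (0 : ℝ) < (n : ℝ) ^ d := by have := Nat.pos_of_ne_zero (NeZero.ne n); positivity
  have hnormW : ∀ W : Tor (fine n M) → Fin d → ℂ, ‖W‖ ^ 2 ≤ (n : ℝ) ^ d * qWV n M W := fun W => by
    unfold qWV
    rw [← mul_assoc, mul_inv_cancel₀ hn0.ne', one_mul]
    exact norm_sq_le_nsqV W
  exact upper_bracket_of_curl_fineSlice (Qk := Qk) (Q₁ := Q₁) (Sc := ScV n M R G) (Sf := SfV n L M R' G') (Sff := SfV n L M R' (fun _ => 0))
    (qW := qWV n M) (qV := qVV n L M) (qZ := nsqV M) (ρ := ρ)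
    hQk (continuous_ScV n M R hGc) (ScV_nonneg n M R hG0) (SfV_nonneg n L M R' hG0') (qWV_nonneg n M) (nsqV_nonneg M) hρ0 hn0.le hΛ hCP hCR hCI hε₁ hδ' hτ hτ' hnormW
    hUBc hPc hREG hONEc hfine φ

end Vector

/-! ## §3 Geometric from a level on (the rate constant of a pre-asymptotic plateau) -/

section Eventually

/-- **GEOMETRIC FROM LEVEL `k₀` ON**: a defect sequence bounded by `B` before level `k₀` and by `C·θ^k` from level `k₀` on is bounded by `max C (B ∕ θ^k₀)·θ^k` at EVERY level
(`0 < θ ≤ 1`) — so the END's decay binders (`δ k ≤ c_δ θ^k`, …, asked for ALL `k`) are met with an inflated constant; the formal content of «a pre-asymptotic plateau through `k₀`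
levels costs a factor `θ^{−k₀}` in the rate constant» (leaf-01-g7's two-level numerics: plateau F-ne2leaf01g7-2, crossover at `n·c ≈ 10–15` F-ne2leaf01g7-3). [folklore] -/
theorem le_geometric_of_eventually {e : ℕ → ℝ} {B C θ : ℝ} {k₀ : ℕ} (hθ : 0 < θ) (hθ1 : θ ≤ 1) (hB : 0 ≤ B)
    (hpre : ∀ k < k₀, e k ≤ B) (hpost : ∀ k ≥ k₀, e k ≤ C * θ ^ k) (k : ℕ) :
    e k ≤ max C (B / θ ^ k₀) * θ ^ k := by
  rcases lt_or_ge k k₀ with hk | hk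
  · have h1 : θ ^ k₀ ≤ θ ^ k := pow_le_pow_of_le_one hθ.le hθ1 hk.le
    have hθk0 : 0 < θ ^ k₀ := pow_pos hθ k₀
    calc e k ≤ B := hpre k hk
      _ = (B / θ ^ k₀) * θ ^ k₀ := by field_simp
      _ ≤ (B / θ ^ k₀) * θ ^ k := mul_le_mul_of_nonneg_left h1 (div_nonneg hB hθk0.le)
      _ ≤ max C (B / θ ^ k₀) * θ ^ k := mul_le_mul_of_nonneg_right (le_max_right _ _) (pow_nonneg hθ.le k)
  · calc e k ≤ C * θ ^ k := hpost k hk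
      _ ≤ max C (B / θ ^ k₀) * θ ^ k := mul_le_mul_of_nonneg_right (le_max_left _ _) (pow_nonneg hθ.le k)

/-- the inflated constant is nonnegative as soon as `0 ≤ B` (whatever the sign of `C`). [folklore] -/
theorem max_div_pow_nonneg {B C θ : ℝ} {k₀ : ℕ} (hθ : 0 < θ) (hB : 0 ≤ B) : 0 ≤ max C (B / θ ^ k₀) :=
  le_max_of_le_right (div_nonneg hB (pow_pos hθ k₀).le)

end Eventually

/-! ## §4 The (C) binder discharged at frame carriers -/

section FrameCarriers

open Literature.MathematicalPhysics.QuantumFieldTheory.Balaban1983to89.B5Block118 (bpt)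
open Summit.QuantumFields.BalabanUV.T4Continuum.VariationalVectorInterpolant (interpV frameT QvL_interpV)
open Summit.QuantumFields.BalabanUV.T4Continuum.VariationalVectorOneStep (plaq)
open Summit.QuantumFields.BalabanUV.T4Continuum.VariationalVectorOneStepPhys (rhoV rhoV_nonneg SfV_interpV_le)
open Summit.QuantumFields.BalabanUV.T4Continuum.VariationalVectorOneStepSlice (qVV_interpV_le)

variable {d : ℕ} {E : Type*} [NormedAddCommGroup E] [InnerProductSpace ℂ E] [CompleteSpace E]
variable (n L : ℕ) [NeZero n] [NeZero L] (M : Fin d → ℕ) [hM : ∀ μ, NeZero (M μ)]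
variable {Rc : Tor (fine n M) → Fin d → (E →L[ℂ] E)} {R' : Tor (fine L (fine n M)) → Fin d → (E →L[ℂ] E)}
variable {U' : Tor (fine L (fine n M)) → (E →L[ℂ] E)} {m p : ℝ}

/-- **LEAF V-ONE's CURL COMPETITOR WITH SIZE CONTROL — the (C) binder `hONEc` of `vector_upper_bracket_curl_fineSlice` DISCHARGED at frame-carrier data** (general `E`;
`Q₁ := QvL L (fine n M) (frameT U′ Rc)`, ANY coarse average `Qk`, `ρ := rhoV n M Rc`, `ε₁ := 4(d+26)L∕n²`, `δ′ := nL√(d(50p²∕L + (32(1+d²)+400)m²)∕2)`, `C_I := 4(1+d²)+50`):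
V-ONE-1F's `SfV_interpV_le` (value clause; hypotheses VERBATIM: unitary `U′`, `Rc`; frame defects `≤ m` in-block and across faces; coarse plaquette defect `≤ p`; `G ≥ 0`) +
`QvL_interpV` + leaf-01-g6's `qVV_interpV_le` (size clause).  The minimality hypothesis of (C) is not used. [folklore] -/
theorem oneStep_vector_sized (hU : ∀ x, U' x ∈ unitary (E →L[ℂ] E)) (hRc1 : ∀ y μ, Rc y μ ∈ unitary (E →L[ℂ] E)) (hm : 0 ≤ m)
    (hin : ∀ (y : Tor (fine n M)) (j : Fin d → Fin L) (μ : Fin d), (j μ : ℕ) + 1 < L →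
      ‖R' (bpt L (fine n M) y j) μ * star (U' (bpt L (fine n M) y j + unitVec (fine L (fine n M)) μ)) - star (U' (bpt L (fine n M) y j))‖ ≤ m)
    (hcross : ∀ (y : Tor (fine n M)) (j : Fin d → Fin L) (μ : Fin d), (j μ : ℕ) + 1 = L →
      ‖R' (bpt L (fine n M) y j) μ * star (U' (bpt L (fine n M) y j + unitVec (fine L (fine n M)) μ))
        - star (U' (bpt L (fine n M) y j)) * Rc y μ‖ ≤ m)
    (hp : ∀ y μ ν, ‖plaq (fine n M) Rc y μ ν‖ ≤ p) {G : (Tor (fine n M) → Fin d → E) → ℝ} (hG0 : ∀ W, 0 ≤ G W)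
    {Qk : (Tor (fine n M) → Fin d → E) → (Tor M → Fin d → E)}
    (φ : Tor M → Fin d → E) (W₀ : Tor (fine n M) → Fin d → E) (hW₀ : Qk W₀ = φ)
    (_hmin : ∀ W, Qk W = φ → ScV n M Rc G W₀ ≤ ScV n M Rc G W) :
    ∃ g₁ : Tor (fine L (fine n M)) → Fin d → E, Qk (QvL L (fine n M) (frameT L (fine n M) U' Rc) g₁) = φ ∧
      SfV n L M R' (fun _ => 0) g₁
        ≤ (Real.sqrt (ScV n M Rc G W₀ + 4 * ((d : ℝ) + 26) * ((L : ℝ) / (n : ℝ) ^ 2) * rhoV n M Rc W₀)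
            + (n : ℝ) * L * Real.sqrt (d * (50 * p ^ 2 / L + (32 * (1 + (d : ℝ) ^ 2) + 400) * m ^ 2) / 2) * Real.sqrt (qWV n M W₀)) ^ 2 ∧
      qVV n L M g₁ ≤ (4 * (1 + (d : ℝ) ^ 2) + 50) * (qWV n M W₀ + ScV n M Rc G W₀ + rhoV n M Rc W₀) := by
  have hRc : ∀ y μ, ‖Rc y μ‖ ≤ 1 := fun y μ => VariationalColourFederbush.norm_le_one_of_mem_unitary (hRc1 y μ)
  refine ⟨interpV L (fine n M) U' Rc W₀, by rw [QvL_interpV L (fine n M) Rc W₀ hU, hW₀], SfV_interpV_le n L M hU hRc1 hm hin hcross hp hG0 W₀, ?_⟩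
  have hS0 : 0 ≤ ScV n M Rc G W₀ := ScV_nonneg n M Rc hG0 W₀
  have hρ0 : 0 ≤ rhoV n M Rc W₀ := rhoV_nonneg n M Rc W₀
  have hC0 : (0 : ℝ) ≤ 4 * (1 + (d : ℝ) ^ 2) + 50 := by positivity
  calc qVV n L M (interpV L (fine n M) U' Rc W₀) ≤ (4 * (1 + (d : ℝ) ^ 2) + 50) * qWV n M W₀ := qVV_interpV_le n L M hU hRc W₀
    _ ≤ (4 * (1 + (d : ℝ) ^ 2) + 50) * (qWV n M W₀ + ScV n M Rc G W₀ + rhoV n M Rc W₀) := by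
      refine mul_le_mul_of_nonneg_left ?_ hC0
      linarith

end FrameCarriers

end Summit.QuantumFields.BalabanUV.T4Continuum.VariationalVectorEndMonotoneCurl

end
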